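import Literature.Geometry.Kaehler.ComplexTorusQuaternionUnitGroupFinitelyGeneratedSplit
import Literature.NumberTheory.Automorphic.QuaternionAlgebraIntegralModel
import Literature.NumberTheory.Automorphic.QuaternionAlgebraStructure
import Literature.NumberTheory.Automorphic.QuaternionAlgebraSplitting
import HarnessLib

/-!
# Normal form of a quaternion algebra over `ℚ` embedded in `M₂(ℝ)`: `B ≅ (a, b)_ℚ` with `a, b ∈ ℤ`, `a ≠ 0 < b`, and `ι = h ρ(·) h⁻¹`

Theorems only (no `def`, no named fact, net debt `0`); part 1 of 2 of the (SIGᶜ)(i) transfer (part 2: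
`…CartanCarayolSigFromFG.lean`). Route `ClassRecordThree`, crux `EulerHalvesAtThree` (item `stmt-BirchSwinnertonDyer-19109`); node
`CartanOnePlaceDegreeLawAtThree` (`stmt-…-24801`, line of record `Lines/lattice`). Purpose: put an ABSTRACT datum `(B, O, ι)` —
`B` a quaternion algebra over `ℚ` (`IsQuaternionAlgebra ℚ B`), `ι : B →ₐ[ℚ] M₂(ℝ)` — into the coordinates of the Hodge lane
`Literature/Geometry/Kaehler/ComplexTorusQuaternion*` (lane `lit-hodgefound`), which works with the explicit family `(a, b)_ℚ`, `a, b ∈ ℤ`,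
`a ≠ 0 < b`, its order `𝔬 = ℤ⟨1, i, j, ij⟩` and the real representation `ρ = QuaternionType.rho a b`:

* `exists_int_pos_nonempty_algEquiv_quaternionAlgebra B ι : ∃ a b : ℤ, a ≠ 0 ∧ 0 < b ∧ Nonempty (B ≃ₐ[ℚ] ℍ[ℚ,a,b])` — Vignéras'
  standard basis (`IsQuaternionAlgebra.exists_algEquiv_quaternionAlgebra`), denominators cleared
  (`QuaternionAlgebra.nonempty_algEquiv_of_eq_mul_sq`), the swap `(a, b)_K ≅ (b, a)_K` (`nonempty_algEquiv_quaternionAlgebra_swap`), and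
  INDEFINITENESS (`pos_or_pos_of_algHom_matrix_real`): if `a, b < 0` the norm form of `(a, b)_ℝ` is anisotropic, so the base change
  `(a, b)_ℝ → M₂(ℝ)` of `ι` would be injective, hence an isomorphism by dimension, and the rank-one idempotent `E₁₁` would be the image of
  an invertible quaternion;
* `exists_units_forall_eq_conj' (ha : a ≠ 0) (hb : 0 < b) (g : ℍ[ℚ,a,b] →ₐ[ℚ] M₂(ℝ)) : ∃ h : GL₂(ℝ), ∀ x, g x = h ρ(x) h⁻¹` —
  Skolem–Noether. DEVIATION: this is `QuaternionType.exists_units_forall_eq_conj` of `…ComplexTorusQuaternionUnitGroupCommensurable`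
  (with its helper `exists_algHom_extension_real`), re-proved here verbatim because that module is outside this file's build closure on
  the checking farm; the proofs use only `QuaternionType.exists_algEquiv_eq_rho` (`…UnitGroupArithmetic`) and the tree's
  `Literature.RingTheory.CentralSimple.Matrix.exists_units_forall_algHom_eq_conj`.

No statement of the summit, of `ClassRecordThree`, or of any crux is proved here; BSD is proved for no curve.

## References
* [VignerasLNM800] M.-F. Vignéras, *Arithmétique des algèbres de quaternions*, LNM 800 (1980), Ch. I §1 (standard basis `{1, i, j, ij}`,
  `(a, b) ≅ (b, a) ≅ (a c², b d²)`, p. 1–3); Ch. IV §1 (`H ⊗ ℝ ≅ M₂(ℝ)` for an embedding in `M₂(ℝ)`).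
* [Voight2021] J. Voight, *Quaternion Algebras*, GTM 288, §7.7 Main Thm. 7.7.1, Cor. 7.7.4 (Skolem–Noether).
* [Bergeron2016] N. Bergeron, *The Spectrum of Hyperbolic Surfaces* (2016), §2.2 proof of Thm. 2.3 (p. 37).
-/

set_option linter.dupNamespace false

noncomputable section

open scoped Classical MatrixGroups Quaternion

namespace Summit.BirchSwinnertonDyer.BirchSwinnertonDyer.Theorems.CartanCarayol

open Literature.NumberTheory.Automorphic
open Literature.Geometry.Kaehler.ComplexTorus
open Literature.Geometry.Kaehler.ComplexTorus.QuaternionType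

/-! ### §2a Normalising the algebra: integral parameters `a ≠ 0 < b` -/

/-- **Swap of parameters** `ℍ[K,a,b] ≅ ℍ[K,b,a]` (`i ↦ j′`, `j ↦ i′`, `ij ↦ -i′j′`; injective since `ℍ[K,a,b]` is simple,
bijective by dimension). [folklore] [cite: VignerasLNM800, Ch. I §1 p. 2] -/
theorem nonempty_algEquiv_quaternionAlgebra_swap {K : Type*} [Field K] [NeZero (2 : K)] {a b : K} (ha : a ≠ 0)
    (hb : b ≠ 0) : Nonempty (ℍ[K,a,b] ≃ₐ[K] ℍ[K,b,a]) := by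
  let q : _root_.QuaternionAlgebra.Basis ℍ[K,b,a] a 0 b :=
    { i := ⟨0, 0, 1, 0⟩, j := ⟨0, 1, 0, 0⟩, k := ⟨0, 0, 0, -1⟩,
      i_mul_i := by ext <;> simp
      j_mul_j := by ext <;> simp
      i_mul_j := by ext <;> simp
      j_mul_i := by ext <;> simp }
  haveI := QuaternionAlgebra.isSimpleRing ha hb
  have hinj : Function.Injective q.liftHom := RingHom.injective q.liftHom.toRingHom
  have hdim : Module.finrank K ℍ[K,a,b] = Module.finrank K ℍ[K,b,a] := by
    rw [QuaternionAlgebra.finrank_eq_four, QuaternionAlgebra.finrank_eq_four]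
  exact ⟨AlgEquiv.ofBijective q.liftHom
    ⟨hinj, (LinearMap.injective_iff_surjective_of_finrank_eq_finrank hdim (f := q.liftHom.toLinearMap)).mp hinj⟩⟩

/-- **Integral parameters**: a quaternion algebra over `ℚ` is `≅ (a, b)_ℚ` with `a, b ∈ ℤ ∖ {0}` (standard basis, then
clear denominators: `(a₀, b₀)_ℚ ≅ (a₀c², b₀d²)_ℚ` with `c, d` the denominators). [cite: VignerasLNM800, Ch. I §1 p. 1–2] -/
theorem exists_int_nonempty_algEquiv_quaternionAlgebra (B : Type*) [Ring B] [Algebra ℚ B] [IsQuaternionAlgebra ℚ B] :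
    ∃ a b : ℤ, a ≠ 0 ∧ b ≠ 0 ∧ Nonempty (B ≃ₐ[ℚ] ℍ[ℚ,(a : ℚ),(b : ℚ)]) := by
  obtain ⟨a₀, b₀, ha₀, hb₀, ⟨e₀⟩⟩ := IsQuaternionAlgebra.exists_algEquiv_quaternionAlgebra ℚ B
  have hda : (a₀.den : ℚ) ≠ 0 := Nat.cast_ne_zero.mpr a₀.den_ne_zero
  have hdb : (b₀.den : ℚ) ≠ 0 := Nat.cast_ne_zero.mpr b₀.den_ne_zero
  have h₁ : ((a₀.num * a₀.den : ℤ) : ℚ) = a₀ * (a₀.den : ℚ) ^ 2 := by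
    push_cast
    rw [sq, ← mul_assoc, Rat.mul_den_eq_num]
  have h₂ : ((b₀.num * b₀.den : ℤ) : ℚ) = b₀ * (b₀.den : ℚ) ^ 2 := by
    push_cast
    rw [sq, ← mul_assoc, Rat.mul_den_eq_num]
  obtain ⟨e₁⟩ := QuaternionAlgebra.nonempty_algEquiv_of_eq_mul_sq ha₀ hb₀ hda hdb h₁ h₂
  exact ⟨a₀.num * a₀.den, b₀.num * b₀.den,
    mul_ne_zero (Rat.num_ne_zero.mpr ha₀) (Int.natCast_ne_zero.mpr a₀.den_ne_zero),
    mul_ne_zero (Rat.num_ne_zero.mpr hb₀) (Int.natCast_ne_zero.mpr b₀.den_ne_zero), ⟨e₀.trans e₁⟩⟩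

/-- A rational scalar of the `ℚ`-algebra `M₂(ℝ)` is the real scalar matrix (re-proof of the private lemma of
`…ComplexTorusQuaternionUnitGroupCommensurable`). [folklore] -/
private theorem algebraMap_rat_matrix (q : ℚ) :
    algebraMap ℚ (Matrix (Fin 2) (Fin 2) ℝ) q = algebraMap ℝ (Matrix (Fin 2) (Fin 2) ℝ) (q : ℝ) := by
  rw [Algebra.algebraMap_eq_smul_one, Algebra.algebraMap_eq_smul_one, Rat.cast_smul_eq_qsmul]

/-- A quaternion in the basis `1, i, j, ij` (re-proof of the private lemma of `…UnitGroupCommensurable`). [folklore] -/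
private theorem eq_basis_sum' {R : Type*} [CommRing R] {a b : ℤ} (x : ℍ[R,(a : R),(b : R)]) :
    x = algebraMap R _ x.re + x.imI • (⟨0, 1, 0, 0⟩ : ℍ[R,(a : R),(b : R)]) +
      x.imJ • (⟨0, 0, 1, 0⟩ : ℍ[R,(a : R),(b : R)]) +
      x.imK • ((⟨0, 1, 0, 0⟩ : ℍ[R,(a : R),(b : R)]) * ⟨0, 0, 1, 0⟩) := by
  ext <;> simp

/-- **Base change of a rational representation `g : Q →ₐ[ℚ] M₂(ℝ)`** to `ψ : (a, b)_ℝ →ₐ[ℝ] M₂(ℝ)` with `ψ = g` on `Q`.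
This is `QuaternionType.exists_algHom_extension_real` of `…ComplexTorusQuaternionUnitGroupCommensurable` (Hodge lane,
p12 g20-#5), re-proved verbatim here because that module is not in the farm's build closure of this file.
[cite: Bergeron2016, §2.2 proof of Thm. 2.3 p. 37] -/
private theorem exists_algHom_extension_real' {a b : ℤ} (g : ℍ[ℚ,(a : ℚ),(b : ℚ)] →ₐ[ℚ] Matrix (Fin 2) (Fin 2) ℝ) :
    ∃ ψ : ℍ[ℝ,(a : ℝ),(b : ℝ)] →ₐ[ℝ] Matrix (Fin 2) (Fin 2) ℝ, ∀ x, ψ (castQ a b x) = g x := by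
  set I : ℍ[ℚ,(a : ℚ),(b : ℚ)] := ⟨0, 1, 0, 0⟩ with hI
  set J : ℍ[ℚ,(a : ℚ),(b : ℚ)] := ⟨0, 0, 1, 0⟩ with hJ
  have hII : I * I = algebraMap ℚ _ (a : ℚ) := by
    rw [hI]; ext <;> simp
  have hJJ : J * J = algebraMap ℚ _ (b : ℚ) := by
    rw [hJ]; ext <;> simp
  have hJI : J * I = -(I * J) := by
    rw [hI, hJ]; ext <;> simp
  have hEi : g I * g I = ((a : ℤ) : ℝ) • (1 : Matrix (Fin 2) (Fin 2) ℝ) + (0 : ℝ) • g I := by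
    rw [zero_smul, add_zero, ← map_mul, hII, AlgHom.commutes, algebraMap_rat_matrix, Algebra.algebraMap_eq_smul_one,
      Rat.cast_intCast]
  have hEj : g J * g J = ((b : ℤ) : ℝ) • (1 : Matrix (Fin 2) (Fin 2) ℝ) := by
    rw [← map_mul, hJJ, AlgHom.commutes, algebraMap_rat_matrix, Algebra.algebraMap_eq_smul_one, Rat.cast_intCast]
  have hEji : g J * g I = (0 : ℝ) • g J - g I * g J := by
    rw [zero_smul, zero_sub, ← map_mul, ← map_mul, hJI, map_neg]
  let q : _root_.QuaternionAlgebra.Basis (Matrix (Fin 2) (Fin 2) ℝ) ((a : ℤ) : ℝ) 0 ((b : ℤ) : ℝ) :=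
    { i := g I, j := g J, k := g I * g J,
      i_mul_i := hEi, j_mul_j := hEj, i_mul_j := rfl, j_mul_i := hEji }
  refine ⟨q.liftHom, fun x ↦ ?_⟩
  rw [QuaternionAlgebra.Basis.liftHom_apply, QuaternionAlgebra.Basis.lift]
  conv_rhs => rw [eq_basis_sum' x]
  simp only [map_add, map_mul, AlgHom.commutes, map_smul, castQ_re, castQ_imI, castQ_imJ, castQ_imK]
  rw [algebraMap_rat_matrix, ← Rat.cast_smul_eq_qsmul ℝ x.imI, ← Rat.cast_smul_eq_qsmul ℝ x.imJ,
    ← Rat.cast_smul_eq_qsmul ℝ x.imK]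

/-- **Skolem–Noether for a rational representation into `M₂(ℝ)`** (`a ≠ 0 < b`): `g(x) = h ρ(x) h⁻¹` for some
`h ∈ GL₂(ℝ)`. This is `QuaternionType.exists_units_forall_eq_conj` of `…ComplexTorusQuaternionUnitGroupCommensurable`,
re-proved verbatim (same reason). [cite: Voight2021, §7.7 Main Thm. 7.7.1 and Cor. 7.7.4] [cite: Bergeron2016, §2.2 proof of Thm. 2.3 p. 37] -/
theorem exists_units_forall_eq_conj' {a b : ℤ} (ha : a ≠ 0) (hb : 0 < b)
    (g : ℍ[ℚ,(a : ℚ),(b : ℚ)] →ₐ[ℚ] Matrix (Fin 2) (Fin 2) ℝ) :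
    ∃ h : GL (Fin 2) ℝ, ∀ x : ℍ[ℚ,(a : ℚ),(b : ℚ)],
      g x = (h : Matrix (Fin 2) (Fin 2) ℝ) * rho a b hb.le (castQ a b x) * ((h⁻¹ : GL (Fin 2) ℝ) : Matrix (Fin 2) (Fin 2) ℝ) := by
  obtain ⟨ψ, hψ⟩ := exists_algHom_extension_real' (a := a) (b := b) g
  obtain ⟨ρ', hρ'⟩ := exists_algEquiv_eq_rho ha hb
  obtain ⟨u, hu⟩ := Literature.RingTheory.CentralSimple.Matrix.exists_units_forall_algHom_eq_conj (K := ℝ)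
    (ψ.comp (ρ'.symm : Matrix (Fin 2) (Fin 2) ℝ →ₐ[ℝ] ℍ[ℝ,(a : ℝ),(b : ℝ)]))
  refine ⟨u, fun x ↦ ?_⟩
  have h1 : ψ (castQ a b x) = (ψ.comp (ρ'.symm : Matrix (Fin 2) (Fin 2) ℝ →ₐ[ℝ] ℍ[ℝ,(a : ℝ),(b : ℝ)]))
      (rho a b hb.le (castQ a b x)) := by
    rw [AlgHom.comp_apply]
    change ψ (castQ a b x) = ψ (ρ'.symm (rho a b hb.le (castQ a b x)))
    rw [← hρ', AlgEquiv.symm_apply_apply]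
  rw [← hψ, h1, hu]

/-- **An algebra embedded in `M₂(ℝ)` is indefinite**: if `(a, b)_ℚ` (`a, b ∈ ℤ ∖ {0}`) admits a `ℚ`-algebra map to
`M₂(ℝ)` then `a > 0` or `b > 0`. (If `a, b < 0` the norm form `x₀² − a x₁² − b x₂² + ab x₃²` of `(a, b)_ℝ` is positive
definite, so the base-changed map `ψ : (a, b)_ℝ → M₂(ℝ)` is injective, hence an isomorphism by dimension; but then the
rank-one idempotent `E₁₁` would be the image of an invertible quaternion.) [cite: VignerasLNM800, Ch. I §1; Ch. IV §1 (H ⊗ ℝ ≅ M₂(ℝ) for a Fuchsian embedding)] -/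
theorem pos_or_pos_of_algHom_matrix_real {a b : ℤ} (ha : a ≠ 0) (hb : b ≠ 0)
    (g : ℍ[ℚ,(a : ℚ),(b : ℚ)] →ₐ[ℚ] Matrix (Fin 2) (Fin 2) ℝ) : 0 < a ∨ 0 < b := by
  by_contra hneg
  push Not at hneg
  have ha' : (a : ℝ) < 0 := by exact_mod_cast lt_of_le_of_ne hneg.1 ha
  have hb' : (b : ℝ) < 0 := by exact_mod_cast lt_of_le_of_ne hneg.2 hb
  obtain ⟨ψ, -⟩ := exists_algHom_extension_real' g
  -- the norm form and its positivity
  have hN : ∀ x : ℍ[ℝ,(a : ℝ),(b : ℝ)], x * star x =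
      algebraMap ℝ _ (x.re ^ 2 - (a : ℝ) * x.imI ^ 2 - (b : ℝ) * x.imJ ^ 2 + (a : ℝ) * (b : ℝ) * x.imK ^ 2) := by
    intro x
    rw [QuaternionAlgebra.algebraMap_eq]
    ext <;> simp <;> ring
  have hpos : ∀ x : ℍ[ℝ,(a : ℝ),(b : ℝ)], x ≠ 0 →
      0 < x.re ^ 2 - (a : ℝ) * x.imI ^ 2 - (b : ℝ) * x.imJ ^ 2 + (a : ℝ) * (b : ℝ) * x.imK ^ 2 := by
    intro x hx
    have hab : 0 < (a : ℝ) * (b : ℝ) := mul_pos_of_neg_of_neg ha' hb'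
    have h0 : 0 ≤ x.re ^ 2 := sq_nonneg _
    have h1 : 0 ≤ -(a : ℝ) * x.imI ^ 2 := mul_nonneg (neg_nonneg.mpr ha'.le) (sq_nonneg _)
    have h2 : 0 ≤ -(b : ℝ) * x.imJ ^ 2 := mul_nonneg (neg_nonneg.mpr hb'.le) (sq_nonneg _)
    have h3 : 0 ≤ (a : ℝ) * (b : ℝ) * x.imK ^ 2 := mul_nonneg hab.le (sq_nonneg _)
    rcases (show x.re ≠ 0 ∨ x.imI ≠ 0 ∨ x.imJ ≠ 0 ∨ x.imK ≠ 0 by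
      by_contra h
      push Not at h
      exact hx (QuaternionAlgebra.ext h.1 h.2.1 h.2.2.1 h.2.2.2)) with h | h | h | h
    · have : 0 < x.re ^ 2 := by positivity
      nlinarith
    · have : 0 < -(a : ℝ) * x.imI ^ 2 := mul_pos (neg_pos.mpr ha') (by positivity)
      nlinarith
    · have : 0 < -(b : ℝ) * x.imJ ^ 2 := mul_pos (neg_pos.mpr hb') (by positivity)
      nlinarith
    · have : 0 < (a : ℝ) * (b : ℝ) * x.imK ^ 2 := mul_pos hab (by positivity)
      nlinarith
  -- `ψ` is injective, hence surjective
  have hinj : Function.Injective ψ := by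
    rw [injective_iff_map_eq_zero]
    intro x hx
    by_contra hx0
    have h1 : ψ (x * star x) = 0 := by rw [map_mul, hx, zero_mul]
    rw [hN, AlgHom.commutes, Algebra.algebraMap_eq_smul_one, smul_eq_zero] at h1
    rcases h1 with h1 | h1
    · exact (hpos x hx0).ne' h1
    · exact one_ne_zero h1
  have hdim : Module.finrank ℝ ℍ[ℝ,(a : ℝ),(b : ℝ)] = Module.finrank ℝ (Matrix (Fin 2) (Fin 2) ℝ) := by
    rw [QuaternionAlgebra.finrank_eq_four, Module.finrank_matrix]
    simp
  have hsurj : Function.Surjective ψ :=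
    (LinearMap.injective_iff_surjective_of_finrank_eq_finrank hdim (f := ψ.toLinearMap)).mp hinj
  -- the rank-one idempotent is not the image of an invertible quaternion
  obtain ⟨x, hx⟩ := hsurj (Matrix.of ![![1, 0], ![0, 0]])
  have hx0 : x ≠ 0 := by
    rintro rfl
    have := congr_fun (congr_fun hx 0) 0
    simp at this
  have h2 : ψ (x * star x) = Matrix.of ![![1, 0], ![0, 0]] * ψ (star x) := by rw [map_mul, hx]
  rw [hN, AlgHom.commutes, Algebra.algebraMap_eq_smul_one] at h2
  have h3 := congr_fun (congr_fun h2 1) 1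
  simp [Matrix.mul_apply, Fin.sum_univ_two] at h3
  exact (hpos x hx0).ne' h3

/-- **Normal form of a quaternion algebra over `ℚ` that embeds in `M₂(ℝ)`**: `B ≅ (a, b)_ℚ` with `a, b ∈ ℤ`, `a ≠ 0`,
`b > 0` (integral parameters, indefiniteness, and the swap `(a, b) ≅ (b, a)` if needed) — the shape in which the Hodge
lane's family `Γ_{a,b} = ρ(𝔬¹)` (`…ComplexTorusQuaternionUnitGroup`) is parametrised. [cite: VignerasLNM800, Ch. I §1, Ch. IV §1] [cite: Bergeron2016, §2.2 Thm. 2.3 p. 36] -/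
theorem exists_int_pos_nonempty_algEquiv_quaternionAlgebra (B : Type*) [Ring B] [Algebra ℚ B] [IsQuaternionAlgebra ℚ B]
    (ι : B →ₐ[ℚ] Matrix (Fin 2) (Fin 2) ℝ) :
    ∃ a b : ℤ, a ≠ 0 ∧ 0 < b ∧ Nonempty (B ≃ₐ[ℚ] ℍ[ℚ,(a : ℚ),(b : ℚ)]) := by
  obtain ⟨a, b, ha, hb, ⟨f⟩⟩ := exists_int_nonempty_algEquiv_quaternionAlgebra B
  rcases pos_or_pos_of_algHom_matrix_real ha hb (ι.comp (f.symm : ℍ[ℚ,(a : ℚ),(b : ℚ)] →ₐ[ℚ] B)) with ha' | hb'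
  · obtain ⟨s⟩ := nonempty_algEquiv_quaternionAlgebra_swap (K := ℚ) (a := (a : ℚ)) (b := (b : ℚ))
      (Int.cast_ne_zero.mpr ha) (Int.cast_ne_zero.mpr hb)
    exact ⟨b, a, hb, ha', ⟨f.trans s⟩⟩
  · exact ⟨a, b, ha, hb', ⟨f⟩⟩

end Summit.BirchSwinnertonDyer.BirchSwinnertonDyer.Theorems.CartanCarayol
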